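import Mathlib
import Summits.ValiantsHypothesis.ValiantsHypothesis.Theses.BarrierLever
import Summits.ValiantsHypothesis.ValiantsHypothesis.Theorems.BarrierLeverDefinableEquationsBalancedStrength
import Summits.ValiantsHypothesis.ValiantsHypothesis.Theorems.BarrierLeverDefinableEquationsBalancedStrengthThin
import Summits.ValiantsHypothesis.ValiantsHypothesis.Theorems.BarrierLeverDefinableEquationsDegreeWindow
import Summits.ValiantsHypothesis.ValiantsHypothesis.Theorems.BarrierLeverDefinableEquationsDegreeWindowThin
import HarnessLib

/-!
# Crux `BarrierLever.DefinableEquations` (stmt-8745) ⟺ `SingleSizeEquations` (stmt-8749) —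
# the CIRCUIT-FREE degree window: balanced strength in a FIXED degree `d ≥ 3b + 3`

The degree-window door (`…DegreeWindow.lean`, `…DegreeWindowDoor.lean`, seat val-np-p5 gen 22)
has as hypothesis class the degree-`d` FORMS of circuit size `≤ (d+2)² n^b` — still a class
defined by circuits.  Composing it with the STRENGTH DOOR of gen 21
(`BalancedStrength.exists_balanced_of_complexity_le`: `hom_d f = Σ_{i < s} g_i h_i` with
`deg g_i, deg h_i ≤ A_d := ⌊(2d+2)/3⌋`, `s = 4 n^b (d+1)² + 1`) gives a CIRCUIT-FREE window:

* §1 for `f ∈ SmallCircuits ℂ n b`, `coeff_d(f)` is `coeff_d` of a member of the BALANCED WINDOW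
  class `BW_d(n, s) = {Σ_{i<s} g_i h_i : deg g_i, deg h_i ≤ A_d}` (written inline), `s = 4n^b(d+1)²+1`
  (`window_vanishing_of_balanced`);
* §2 THE DOOR: level-`a` Boolean-sum equations in the degree-`d` window variables vanishing on
  `BW_d(n, 4n^b(d+1)²+1)`, `d` fixed, eventually in `n` ⇒ the inner statement of the crux at `b`
  (`singleSize_at_of_balancedWindow_equations`), and the route declarations
  `SingleSizeEquations` / `DefinableEquations` (`singleSizeEquations_of_balancedWindow_equations`,
  `definableEquations_of_balancedWindow_equations`);
* §3 THIN: `2 s · C(n + A_d, A_d) < C(n + d - 1, d)` ⇒ a NONZERO window polynomial vanishes on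
  `BW_d(n, s)` (parameter count of gen 21's `coeff_sum_mul_eq_eval` / `exists_aeval_eq_zero_of_card_lt`,
  now against the `C(n+d-1,d)` window coordinates instead of the `C(2n-1,n)` top ones);
* §4 COUNT: for `d = 3b + 3` (`A_d = 2b + 2`, so `b + A_d = d - 1`) the count holds for
  `n > (3b+3)! · 2 (4(3b+4)² + 1) · 2^{2b+2}` (`balancedWindow_count_eventually`); hence
  (`exists_balancedWindowEquation_eventually`) the circuit-free window door is not vacuous in
  CONSTANT degree `3b + 3` — at the open rung `b = 2`: degree-`9` forms in `n` variables of
  `(2/3)`-balanced strength `≤ 400 n² + 1` (summands `g·h` with `deg g, deg h ≤ 6`).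

READING (honest).  This is the planner's "weaker door: balanced strength with a degree window"
(STATUS l.1402) made precise: the window can be taken of CONSTANT degree, the class is circuit-free
and thin, the ambient dimension is `C(n+d-1, d) = poly(n)` and the budget `N^a = 2^{Θ(n)}` is
exponential in it.  In print, equations for (degree-restricted) strength `≤ r` are known only for
`r ≤ (number of variables)/2` (singular locus; Ruppert-type syzygies, arXiv:2509.12322 §4); the
window needs `r = 4n^b(d+1)²+1 ≫ n/2`, and in fixed degree `d` the strength of EVERY form is
`≤ C(n - 1 + ⌈(d-2)/3⌉, ⌈(d-2)/3⌉)` trivially, so singular-locus arguments are void here: OPEN and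
UNWALLED, as for the degree-`n` strength door, but now in a polynomial-dimensional ambient space.
It is a DOOR (sufficient, not equivalent).  Verdicts unchanged: 8745/8749 OPEN at `b = 2`
(Chatterjee–Tengse 2023 §1.3 dir. 2); nothing on crux 14610 or `VP ≠ VNP`, which is NOT proved.
No definitions, no named facts; standard axioms.

References: Forbes–Shpilka–Volk 2018, Def. 1; Valiant–Skyum–Berkowitz–Rackoff 1983 (frontier
identity, via gen 21); Gesmundo–Ghosal–Ikenmeyer–Lysikov 2022 (degree-restricted strength);
Bürgisser–Clausen–Shokrollahi 1997 §9.1 (parameter counts).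
-/

set_option linter.dupNamespace false

noncomputable section

namespace Summit.ValiantsHypothesis.ValiantsHypothesis.Theorems.BarrierLeverDefinableEquations

open MvPolynomial
open Literature.Computability.AlgebraicComplexity Literature.Barriers.ValiantsHypothesis
open scoped BigOperators

namespace DegreeWindow

/-! ## §1 The balanced window of `SmallCircuits ℂ n b` -/

/-- **The degree-`d` window of the crux's class lies in the balanced window**: for
`f ∈ SmallCircuits ℂ n b`, `coeff_d(f) = coeff_d(Σ_{i<s} g_i h_i)` for some `g_i, h_i` of degree
`≤ ⌊(2d+2)/3⌋`, `s = 4n^b(d+1)² + 1`; hence a window polynomial vanishing on the balanced window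
class vanishes at `coeff_d(f)`. [cite: ValiantSkyumBerkowitzRackoff1983, frontier identity] -/
theorem window_vanishing_of_balanced {n b d : ℕ} {E : MvPolynomial (GKSS2017.homMonomials n d) ℂ}
    (hE : ∀ g : MvPolynomial (Fin n) ℂ,
      (∃ gg hh : Fin (4 * n ^ b * (d + 1) ^ 2 + 1) → MvPolynomial (Fin n) ℂ,
        (∀ i, (gg i).totalDegree ≤ (2 * d + 2) / 3 ∧ (hh i).totalDegree ≤ (2 * d + 2) / 3) ∧
        g = ∑ i, gg i * hh i) →
      eval (coeffVector (GKSS2017.homMonomials n d) g) E = 0) :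
    ∀ f ∈ SmallCircuits ℂ n b, eval (coeffVector (GKSS2017.homMonomials n d) f) E = 0 := by
  intro f hf
  obtain ⟨gg, hh, hdeg, hsum⟩ :=
    BalancedStrength.exists_balanced_of_complexity_le (d := d) f hf.2 le_rfl
  rw [coeffVector_homMonomials_eq_homogeneousComponent, hsum]
  exact hE _ ⟨gg, hh, hdeg, rfl⟩

/-! ## §2 The circuit-free window door -/

/-- **The balanced-window door at `b`.** If for some FIXED degree `d` there are a level `a` and
`n₀` such that for all `n ≥ n₀` a level-`a` Boolean-sum datum in the degree-`d` window variables
has a NONZERO Boolean sum vanishing at `coeff_d` of every `Σ_{i<s} g_i h_i` with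
`deg g_i, deg h_i ≤ ⌊(2d+2)/3⌋`, `s = 4n^b(d+1)²+1`, then the inner statement of the crux holds at `b`.
[cite: ForbesShpilkaVolk2018, Def. 1] -/
theorem singleSize_at_of_balancedWindow_equations (b d : ℕ)
    (hE : ∃ a n₀ : ℕ, ∀ n ≥ n₀, ∃ q : ℕ, q ≤ (Nat.choose (2 * n) n) ^ a ∧
      ∃ H' : MvPolynomial (GKSS2017.homMonomials n d ⊕ Fin q) ℂ,
        complexity H' ≤ (Nat.choose (2 * n) n) ^ a ∧ H'.totalDegree ≤ (Nat.choose (2 * n) n) ^ a ∧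
        boolSum H' ≠ 0 ∧
        ∀ g : MvPolynomial (Fin n) ℂ,
          (∃ gg hh : Fin (4 * n ^ b * (d + 1) ^ 2 + 1) → MvPolynomial (Fin n) ℂ,
            (∀ i, (gg i).totalDegree ≤ (2 * d + 2) / 3 ∧ (hh i).totalDegree ≤ (2 * d + 2) / 3) ∧
            g = ∑ i, gg i * hh i) →
          eval (coeffVector (GKSS2017.homMonomials n d) g) (boolSum H') = 0) :
    ∃ a n₀ : ℕ, ∀ n ≥ n₀, ∃ q : ℕ, q ≤ (Nat.choose (2 * n) n) ^ a ∧
      ∃ H : MvPolynomial (↥(degLEMonomials n) ⊕ Fin q) ℂ,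
        complexity H ≤ (Nat.choose (2 * n) n) ^ a ∧ H.totalDegree ≤ (Nat.choose (2 * n) n) ^ a ∧
        boolSum H ≠ 0 ∧
        ∀ f ∈ SmallCircuits ℂ n b, eval (coeffVector (degLEMonomials n) f) (boolSum H) = 0 := by
  obtain ⟨a, n₀, hn₀⟩ := hE
  refine ⟨a, max n₀ d, fun n hn => ?_⟩
  have hdn : d ≤ n := le_of_max_le_right hn
  obtain ⟨q, hq, H', hc, hdeg, hne, hvan⟩ := hn₀ n (le_of_max_le_left hn)
  obtain ⟨H, hHc, hHd, hHne, hHeval⟩ := exists_datum_of_windowDatum hdn H' hc hdeg hne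
  refine ⟨q, hq, H, hHc, hHd, hHne, fun f hf => ?_⟩
  rw [hHeval]
  exact window_vanishing_of_balanced hvan f hf

/-- **The balanced-window door for the support item**: for every `b` a fixed degree `d(b)` and a
level `a(b)` with window equations for the balanced window class ⇒ `BarrierLever.SingleSizeEquations`
(stmt-ValiantsHypothesis-8749). [cite: ForbesShpilkaVolk2018, Def. 1] -/
theorem singleSizeEquations_of_balancedWindow_equations
    (hE : ∀ b : ℕ, ∃ d a n₀ : ℕ, ∀ n ≥ n₀, ∃ q : ℕ, q ≤ (Nat.choose (2 * n) n) ^ a ∧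
      ∃ H' : MvPolynomial (GKSS2017.homMonomials n d ⊕ Fin q) ℂ,
        complexity H' ≤ (Nat.choose (2 * n) n) ^ a ∧ H'.totalDegree ≤ (Nat.choose (2 * n) n) ^ a ∧
        boolSum H' ≠ 0 ∧
        ∀ g : MvPolynomial (Fin n) ℂ,
          (∃ gg hh : Fin (4 * n ^ b * (d + 1) ^ 2 + 1) → MvPolynomial (Fin n) ℂ,
            (∀ i, (gg i).totalDegree ≤ (2 * d + 2) / 3 ∧ (hh i).totalDegree ≤ (2 * d + 2) / 3) ∧
            g = ∑ i, gg i * hh i) →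
          eval (coeffVector (GKSS2017.homMonomials n d) g) (boolSum H') = 0) :
    Summit.ValiantsHypothesis.ValiantsHypothesis.Theses.BarrierLever.SingleSizeEquations := by
  intro b
  obtain ⟨d, a, n₀, h⟩ := hE b
  exact singleSize_at_of_balancedWindow_equations b d ⟨a, n₀, h⟩

/-- **The balanced-window door for the crux with one level `a`** ⇒ `BarrierLever.DefinableEquations`
(stmt-ValiantsHypothesis-8745). [cite: ForbesShpilkaVolk2018, Def. 1] -/
theorem definableEquations_of_balancedWindow_equations
    (hE : ∃ a : ℕ, ∀ b : ℕ, ∃ d n₀ : ℕ, ∀ n ≥ n₀, ∃ q : ℕ, q ≤ (Nat.choose (2 * n) n) ^ a ∧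
      ∃ H' : MvPolynomial (GKSS2017.homMonomials n d ⊕ Fin q) ℂ,
        complexity H' ≤ (Nat.choose (2 * n) n) ^ a ∧ H'.totalDegree ≤ (Nat.choose (2 * n) n) ^ a ∧
        boolSum H' ≠ 0 ∧
        ∀ g : MvPolynomial (Fin n) ℂ,
          (∃ gg hh : Fin (4 * n ^ b * (d + 1) ^ 2 + 1) → MvPolynomial (Fin n) ℂ,
            (∀ i, (gg i).totalDegree ≤ (2 * d + 2) / 3 ∧ (hh i).totalDegree ≤ (2 * d + 2) / 3) ∧
            g = ∑ i, gg i * hh i) →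
          eval (coeffVector (GKSS2017.homMonomials n d) g) (boolSum H') = 0) :
    Summit.ValiantsHypothesis.ValiantsHypothesis.Theses.BarrierLever.DefinableEquations := by
  obtain ⟨a, ha⟩ := hE
  refine ⟨a, fun b => ?_⟩
  obtain ⟨d, n₀, hn₀⟩ := ha b
  obtain ⟨a', n₁, h⟩ := singleSize_at_of_balancedWindow_equations b d ⟨a, n₀, hn₀⟩
  -- re-run the door with the level pinned to `a`
  refine ⟨max n₀ d, fun n hn => ?_⟩
  have hdn : d ≤ n := le_of_max_le_right hn
  obtain ⟨q, hq, H', hc, hdeg, hne, hvan⟩ := hn₀ n (le_of_max_le_left hn)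
  obtain ⟨H, hHc, hHd, hHne, hHeval⟩ := exists_datum_of_windowDatum hdn H' hc hdeg hne
  refine ⟨q, hq, H, hHc, hHd, hHne, fun f hf => ?_⟩
  rw [hHeval]
  exact window_vanishing_of_balanced hvan f hf

/-! ## §3 The balanced window is thin -/

/-- **Thinness of the balanced window (parameter count).** If `2 s · C(n + A, A) < C(n + d - 1, d)`
with `A = ⌊(2d+2)/3⌋` — fewer coefficients of the `2s` factors than degree-`d` window coordinates —
then some NONZERO polynomial in the degree-`d` window variables vanishes at `coeff_d(Σ_{i<s} g_i h_i)`
for all `g_i, h_i` of degree `≤ A`. [cite: BurgisserClausenShokrollahi1997, §9.1] -/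
theorem exists_balancedWindowEquation {n d s : ℕ}
    (hcount : 2 * s * (n + (2 * d + 2) / 3).choose ((2 * d + 2) / 3) < (n + d - 1).choose d) :
    ∃ E : MvPolynomial (GKSS2017.homMonomials n d) ℂ, E ≠ 0 ∧
      ∀ g : MvPolynomial (Fin n) ℂ,
        (∃ gg hh : Fin s → MvPolynomial (Fin n) ℂ,
          (∀ i, (gg i).totalDegree ≤ (2 * d + 2) / 3 ∧ (hh i).totalDegree ≤ (2 * d + 2) / 3) ∧
          g = ∑ i, gg i * hh i) →
        eval (coeffVector (GKSS2017.homMonomials n d) g) E = 0 := by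
  classical
  set A : ℕ := (2 * d + 2) / 3 with hA
  haveI := BalancedStrength.finite_degLE n A
  haveI := finite_homMonomials n d
  let τ : Type := Fin s × Bool × {m : Fin n →₀ ℕ // m.degree ≤ A}
  let Φ : GKSS2017.homMonomials n d → MvPolynomial τ ℂ := fun μ =>
    ∑ i : Fin s, ∑ p ∈ Finset.HasAntidiagonal.antidiagonal (μ : Fin n →₀ ℕ),
      if hp : p.1.degree ≤ A ∧ p.2.degree ≤ A then
        X (i, true, ⟨p.1, hp.1⟩) * X (i, false, ⟨p.2, hp.2⟩) else 0
  have hτ : Nat.card τ = 2 * s * (n + A).choose A := by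
    simp only [τ, Nat.card_prod, Nat.card_eq_fintype_card, Fintype.card_fin, Fintype.card_bool]
    rw [GKSS2017.ncard_degLE]
    ring
  have hlt : Nat.card τ < Nat.card (GKSS2017.homMonomials n d) := by
    rw [hτ, natCard_homMonomials]; exact hcount
  obtain ⟨P, hP0, hP⟩ := BalancedStrength.exists_aeval_eq_zero_of_card_lt hlt Φ
  refine ⟨P, hP0, ?_⟩
  rintro g ⟨gg, hh, hgh, rfl⟩
  let pt : τ → ℂ := fun v => if v.2.1 then coeff v.2.2.1 (gg v.1) else coeff v.2.2.1 (hh v.1)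
  have key : ∀ μ : GKSS2017.homMonomials n d,
      coeffVector (GKSS2017.homMonomials n d) (∑ i, gg i * hh i) μ = eval pt (Φ μ) := by
    intro μ
    rw [coeffVector_apply]
    exact BalancedStrength.coeff_sum_mul_eq_eval gg hh (fun i => (hgh i).1) (fun i => (hgh i).2) _
  have hfun : coeffVector (GKSS2017.homMonomials n d) (∑ i, gg i * hh i) = fun μ => eval pt (Φ μ) :=
    funext key
  rw [hfun]
  have h1 : aeval pt (aeval Φ P) = 0 := by rw [hP, map_zero]
  rw [aeval_eq_bind₁ Φ, aeval_bind₁] at h1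
  exact h1

/-! ## §4 The count at `d = 3b + 3`: the circuit-free window is not vacuous in constant degree -/

/-- `⌊(2(3b+3)+2)/3⌋ = 2b + 2`. [folklore] -/
theorem balanced_bound_three (b : ℕ) : (2 * (3 * b + 3) + 2) / 3 = 2 * b + 2 := by omega

/-- **The count at `d = 3b+3`, eventually**: for
`n ≥ (3b+3)! · (2 (4 (3b+4)² + 1) · 2^(2b+2)) + 2b + 3`,
`2 (4n^b(d+1)²+1) · C(n + 2b + 2, 2b + 2) < C(n + d - 1, d)` with `d = 3b + 3`. [folklore] -/
theorem balancedWindow_count_eventually (b : ℕ) {n : ℕ}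
    (hn : (3 * b + 3).factorial * (2 * (4 * (3 * b + 4) ^ 2 + 1) * 2 ^ (2 * b + 2)) + (2 * b + 3) ≤ n) :
    2 * (4 * n ^ b * (3 * b + 3 + 1) ^ 2 + 1) *
        (n + (2 * (3 * b + 3) + 2) / 3).choose ((2 * (3 * b + 3) + 2) / 3) <
      (n + (3 * b + 3) - 1).choose (3 * b + 3) := by
  rw [balanced_bound_three]
  set A := 2 * b + 2 with hA
  set d := 3 * b + 3 with hd
  set K := 2 * (4 * (3 * b + 4) ^ 2 + 1) * 2 ^ A with hK
  have hfac : 1 ≤ d.factorial := Nat.one_le_iff_ne_zero.mpr (Nat.factorial_ne_zero _)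
  have hK1 : 0 < K := by rw [hK]; positivity
  have hnA : A ≤ n := by
    have : 1 ≤ d.factorial * K := Nat.one_le_iff_ne_zero.mpr (Nat.mul_ne_zero
      (Nat.factorial_ne_zero _) (by omega))
    omega
  have hn1 : 1 ≤ n := le_trans (by omega) hnA
  -- (1) `C(n + A, A) ≤ (2n)^A`
  have h1 : (n + A).choose A ≤ (2 * n) ^ A :=
    (Nat.choose_le_pow _ _).trans (Nat.pow_le_pow_left (by omega) _)
  -- (2) `4 n^b (d+1)² + 1 ≤ (4 (d+1)² + 1) n^b`
  have hnb : 1 ≤ n ^ b := Nat.one_le_pow _ _ hn1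
  have h2 : 4 * n ^ b * (d + 1) ^ 2 + 1 ≤ (4 * (d + 1) ^ 2 + 1) * n ^ b := by nlinarith
  -- (3) the left side is `≤ K · n^(b + A) = K · n^(d-1)`
  have hbA : b + A = d - 1 := by omega
  have h3 : 2 * (4 * n ^ b * (d + 1) ^ 2 + 1) * (n + A).choose A ≤ K * n ^ (d - 1) := by
    calc 2 * (4 * n ^ b * (d + 1) ^ 2 + 1) * (n + A).choose A
        ≤ 2 * ((4 * (d + 1) ^ 2 + 1) * n ^ b) * (2 * n) ^ A := by gcongr
      _ = (2 * (4 * (d + 1) ^ 2 + 1) * 2 ^ A) * n ^ (b + A) := by rw [mul_pow, pow_add]; ring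
      _ = K * n ^ (d - 1) := by rw [hbA, hK, hd]
  -- (4) `d! · K · n^(d-1) < n^d ≤ d! · C(n+d-1, d)`
  have h4 : d.factorial * (K * n ^ (d - 1)) < n ^ d := by
    have hdpos : d = (d - 1) + 1 := by omega
    calc d.factorial * (K * n ^ (d - 1)) = (d.factorial * K) * n ^ (d - 1) := by ring
      _ < n * n ^ (d - 1) := Nat.mul_lt_mul_of_pos_right (by omega) (Nat.one_le_pow _ _ hn1)
      _ = n ^ d := by conv_rhs => rw [hdpos, pow_succ]; ring
  have h5 := pow_le_factorial_mul_choose n d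
  have h6 : d.factorial * (2 * (4 * n ^ b * (d + 1) ^ 2 + 1) * (n + A).choose A) <
      d.factorial * (n + d - 1).choose d := by
    calc d.factorial * (2 * (4 * n ^ b * (d + 1) ^ 2 + 1) * (n + A).choose A)
        ≤ d.factorial * (K * n ^ (d - 1)) := Nat.mul_le_mul_left _ h3
      _ < n ^ d := h4
      _ ≤ d.factorial * (n + d - 1).choose d := h5
  exact Nat.lt_of_mul_lt_mul_left h6

/-- **The circuit-free window door is not vacuous in constant degree `3b + 3`.** For every `b`,
eventually in `n`, a NONZERO polynomial in the `C(n+3b+2, 3b+3)` degree-`(3b+3)` window variables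
vanishes at `coeff_{3b+3}` of every `Σ_{i<s} g_i h_i`, `deg g_i, deg h_i ≤ 2b + 2`,
`s = 4n^b(3b+4)² + 1` — and hence (§1) at `coeff_{3b+3}(f)` for every `f ∈ SmallCircuits ℂ n b`.
[cite: BurgisserClausenShokrollahi1997, §9.1] -/
theorem exists_balancedWindowEquation_eventually (b : ℕ) : ∃ n₀ : ℕ, ∀ n ≥ n₀,
    ∃ E : MvPolynomial (GKSS2017.homMonomials n (3 * b + 3)) ℂ, E ≠ 0 ∧
      (∀ g : MvPolynomial (Fin n) ℂ,
        (∃ gg hh : Fin (4 * n ^ b * (3 * b + 3 + 1) ^ 2 + 1) → MvPolynomial (Fin n) ℂ,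
          (∀ i, (gg i).totalDegree ≤ (2 * (3 * b + 3) + 2) / 3 ∧
            (hh i).totalDegree ≤ (2 * (3 * b + 3) + 2) / 3) ∧
          g = ∑ i, gg i * hh i) →
        eval (coeffVector (GKSS2017.homMonomials n (3 * b + 3)) g) E = 0) ∧
      ∀ f ∈ SmallCircuits ℂ n b,
        eval (coeffVector (GKSS2017.homMonomials n (3 * b + 3)) f) E = 0 := by
  refine ⟨(3 * b + 3).factorial * (2 * (4 * (3 * b + 4) ^ 2 + 1) * 2 ^ (2 * b + 2)) + (2 * b + 3),
    fun n hn => ?_⟩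
  obtain ⟨E, hE0, hE⟩ := exists_balancedWindowEquation (n := n) (d := 3 * b + 3)
    (s := 4 * n ^ b * (3 * b + 3 + 1) ^ 2 + 1) (balancedWindow_count_eventually b hn)
  exact ⟨E, hE0, hE, window_vanishing_of_balanced hE⟩

/-- **At the open rung `b = 2`**: eventually in `n`, a nonzero polynomial in the `C(n+8, 9)`
degree-`9` window variables vanishes at `coeff_9` of every form of `(2/3)`-balanced strength
`≤ 400 n² + 1` (summands `g·h`, `deg g, deg h ≤ 6`), in particular on the degree-`9` window of
`SmallCircuits ℂ n 2`; an EXPLICIT such polynomial (level-`a` Boolean sum) would settle the crux at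
`b = 2` (§2). [cite: BurgisserClausenShokrollahi1997, §9.1] -/
theorem balancedWindow_nine_two : ∃ n₀ : ℕ, ∀ n ≥ n₀,
    ∃ E : MvPolynomial (GKSS2017.homMonomials n 9) ℂ, E ≠ 0 ∧
      (∀ g : MvPolynomial (Fin n) ℂ,
        (∃ gg hh : Fin (4 * n ^ 2 * (9 + 1) ^ 2 + 1) → MvPolynomial (Fin n) ℂ,
          (∀ i, (gg i).totalDegree ≤ (2 * 9 + 2) / 3 ∧ (hh i).totalDegree ≤ (2 * 9 + 2) / 3) ∧
          g = ∑ i, gg i * hh i) →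
        eval (coeffVector (GKSS2017.homMonomials n 9) g) E = 0) ∧
      ∀ f ∈ SmallCircuits ℂ n 2, eval (coeffVector (GKSS2017.homMonomials n 9) f) E = 0 :=
  exists_balancedWindowEquation_eventually 2

end DegreeWindow

end Summit.ValiantsHypothesis.ValiantsHypothesis.Theorems.BarrierLeverDefinableEquations
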